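import Mathlib
import Summits.Langlands.Langlands.Theorems.CapacityClassicalityHilbertIntegralOverconvergentIsCongruenceStubMvWeightedNormMul

/-!
# Crux `HilbertIntegralOverconvergentIsCongruence` (stmt-Langlands-8485), line `Sketch-ideate-r1-k1`, RESHAPE 16 (§ T):
# registered stub T5 `stub_mvWeightedNorm_multisetProd`

Archimedean weighted sizes of finite products (from the landed S1 `stub_mvWeightedNormMul`).
-/

set_option linter.dupNamespace false

noncomputable section

namespace Summit.Langlands.Langlands.Theorems.HilbertIntegralOverconvergentIsCongruence

open scoped NumberField

/-- Weighted `ℓ¹` sizes of finite products: for an additive weight `wt : (σ →₀ ℕ) →+ ℕ`, `t ≥ 0`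
and `B ≥ 1`, if every member `φ` of a multiset `s` of complex multivariable power series has
summable weighted size `W_t(φ) = ∑_ν ‖φ_ν‖ t ^ (wt ν) ≤ B`, then `W_t(s.prod)` is summable and
`W_t(s.prod) ≤ B ^ card s`. Proof: induction on `s`; the empty product is `1`, whose size is the
single term `‖1‖ t ^ (wt 0) = 1 = B ^ 0` (`hasSum_single`); the cons step is the
submultiplicativity `stub_mvWeightedNormMul` followed by `W_t(a) W_t(s.prod) ≤ B * B ^ card s`.
[folklore] -/
theorem stub_mvWeightedNorm_multisetProd {σ : Type} (wt : (σ →₀ ℕ) →+ ℕ) (t : ℝ) (ht : 0 ≤ t) (B : ℝ) (hB : 1 ≤ B)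
    (s : Multiset (MvPowerSeries σ ℂ))
    (hs : ∀ φ ∈ s, Summable (fun n : σ →₀ ℕ ↦ ‖MvPowerSeries.coeff n φ‖ * t ^ wt n) ∧
      ∑' n : σ →₀ ℕ, ‖MvPowerSeries.coeff n φ‖ * t ^ wt n ≤ B) :
    Summable (fun n : σ →₀ ℕ ↦ ‖MvPowerSeries.coeff n s.prod‖ * t ^ wt n) ∧
      ∑' n : σ →₀ ℕ, ‖MvPowerSeries.coeff n s.prod‖ * t ^ wt n ≤ B ^ Multiset.card s := by
  classical
  induction s using Multiset.induction_on with
  | empty =>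
    rw [Multiset.prod_zero, Multiset.card_zero, pow_zero]
    have h0 : ∀ n : σ →₀ ℕ, n ≠ 0 →
        ‖MvPowerSeries.coeff n (1 : MvPowerSeries σ ℂ)‖ * t ^ wt n = 0 := fun n hn ↦ by
      rw [MvPowerSeries.coeff_one, if_neg hn, norm_zero, zero_mul]
    have hsum := hasSum_single (f := fun n : σ →₀ ℕ ↦
      ‖MvPowerSeries.coeff n (1 : MvPowerSeries σ ℂ)‖ * t ^ wt n) 0 h0
    refine ⟨hsum.summable, ?_⟩
    rw [hsum.tsum_eq, MvPowerSeries.coeff_zero_one, norm_one, one_mul, map_zero, pow_zero]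
  | cons a s ih =>
    have ha := hs a (Multiset.mem_cons_self a s)
    have ih' := ih fun φ hφ ↦ hs φ (Multiset.mem_cons_of_mem hφ)
    obtain ⟨hS, hle⟩ := stub_mvWeightedNormMul wt a s.prod t ht ha.1 ih'.1
    rw [Multiset.prod_cons, Multiset.card_cons, pow_succ']
    exact ⟨hS, hle.trans (mul_le_mul ha.2 ih'.2
      (tsum_nonneg fun n ↦ mul_nonneg (norm_nonneg _) (pow_nonneg ht _))
      (zero_le_one.trans hB))⟩

end Summit.Langlands.Langlands.Theorems.HilbertIntegralOverconvergentIsCongruence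

end
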